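import Summits.QuantumFields.YangMills.Theorems.TunedSequenceExists.Negative.Freezing
import Summits.QuantumFields.YangMills.Theorems.ParabolicTrajectoryContinuumLimitOnTrajectoryDefsC
import Summits.QuantumFields.YangMills.Theorems.ParabolicTrajectoryContinuumLimitOnTrajectoryStubOSLegsA_Lattice
import Summits.QuantumFields.YangMills.Theorems.ParabolicTrajectoryContinuumLimitOnTrajectoryDefsE
import Summits.QuantumFields.YangMills.Theorems.ParabolicTrajectoryContinuumLimitOnTrajectoryUclDefs

/-!
# `ContinuumLimitExists` — negative side I: centred plaquette-string moments FREEZE on a fixed torus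

Support file (tightness certificate, part I) for crux `stmt-QuantumFields-16124`
(`Summit.QuantumFields.YangMills.Theses.OneCertifiedCube.ContinuumLimitExists`), line `birth`, lead
prover `prover-line-stmt-QuantumFields-16124-0`, cycle 2 (2026-08-17).

On a FIXED torus of side `2L+1`, for every compact `G` and faithful unitary lattice representation `r`,
every centred moment of a string of single-plaquette / action-density observables placed at arbitrary
sites tends to `0` as `β → ∞`:
`∫ ∏ᵢ (Oᵢ(τ_{xᵢ} Ũ) − ⟨Oᵢ⟩_{β,2L+1}) dμ_β → 0` (`tendsto_centredMoment`), uniformly over all strings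
of length `≤ k` and all positions in `box 4 L` in the sense of ONE eventual threshold
(`eventually_abs_centredMoment_le`). Mechanism: Laplace concentration of Wilson's measure on the flat
configurations (the landed `TunedSequenceExists.Negative.Freezing.tendsto_integral_wilsonMeasure`),
where every plaquette trace is frozen at `N` and the action density at `6N`; a product of centred
bounded factors is bounded by `(2B)^{p-1}` times ONE centred factor, whose `L¹` norm freezes.

Part II (`OvercooledCanonicalScheme`) turns the thresholds into the over-cooled canonical scheme
(all canonical `n`-point functions tend to `0`), which satisfies every conjunct of the line's
`∃`-stub `stub_uvScheme` except `ND2`/`ND3`, and both `∀`-stub conclusions `Rot345`, `CoreClustering`.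
No `sorry`; axioms `propext`, `Classical.choice`, `Quot.sound`.
-/

noncomputable section

open Filter Topology MeasureTheory Finset
open Literature.MathematicalPhysics.QuantumFieldTheory Literature.MathematicalPhysics.QuantumLattice
open Literature.Probability.LatticeModels
open Summit.QuantumFields.YangMills.Cruxes.ContinuumLimitOnTrajectory.TwoOrbitSynchronisation
open Summit.QuantumFields.YangMills.Theorems.TunedSequenceExists.Negative.Freezing

namespace Summit.QuantumFields.YangMills.Theorems.ContinuumLimitExists.Negative

variable {G : Type} [Group G] [TopologicalSpace G] [IsTopologicalGroup G] [CompactSpace G]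
  [MeasurableSpace G] [BorelSpace G]

/-! ## §1 An abstract freezing lemma for products of centred bounded observables -/

omit [TopologicalSpace G] [IsTopologicalGroup G] [CompactSpace G] [MeasurableSpace G] [BorelSpace G] in
/-- Pointwise bound: a product of `p ≥ 1` factors each bounded by `2B` in modulus is at most
`(2B)^{p-1}` times the modulus of the factor `i₀`. -/
theorem abs_prod_le_pow_mul_abs {p : ℕ} (i₀ : Fin p) (f : Fin p → ℝ) {B : ℝ}
    (hf : ∀ i, |f i| ≤ 2 * B) : |∏ i, f i| ≤ (2 * B) ^ (p - 1) * |f i₀| := by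
  have hB : 0 ≤ 2 * B := (abs_nonneg _).trans (hf i₀)
  rw [← Finset.mul_prod_erase Finset.univ f (Finset.mem_univ i₀), abs_mul, mul_comm]
  refine mul_le_mul_of_nonneg_right ?_ (abs_nonneg _)
  rw [Finset.abs_prod]
  calc ∏ i ∈ Finset.univ.erase i₀, |f i| ≤ ∏ _i ∈ Finset.univ.erase i₀, (2 * B) :=
        Finset.prod_le_prod (fun i _ => abs_nonneg _) fun i _ => hf i
    _ = (2 * B) ^ (p - 1) := by
        rw [Finset.prod_const, Finset.card_erase_of_mem (Finset.mem_univ _), Finset.card_univ,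
          Fintype.card_fin]

/-- **Products of centred, bounded, continuous torus observables freeze.** On a fixed torus, if each
`gᵢ` is continuous, bounded by `B`, and constant `= vᵢ` on the flat configurations, and the centring
constants `cᵢ(β)` are bounded by `B` and tend to `vᵢ`, then `∫ ∏ᵢ (gᵢ − cᵢ(β)) dμ_β → 0` as `β → ∞`
(`p ≥ 1`). -/
theorem tendsto_integral_prod_sub [SecondCountableTopology G] {N : ℕ} {S : ℕ} [NeZero S]
    (ρ : G →* Matrix (Fin N) (Fin N) ℂ) (hρ : Continuous ρ) (hρN : ∀ g, (ρ g).trace.re ≤ N)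
    {p : ℕ} (i₀ : Fin p) {g : Fin p → GaugeConfig 4 S G → ℝ} (hg : ∀ i, Continuous (g i))
    {v : Fin p → ℝ} (hv : ∀ i U, wilsonAction ρ U = 0 → g i U = v i)
    {B : ℝ} (hB : ∀ i U, |g i U| ≤ B) {c : Fin p → ℝ → ℝ} (hcB : ∀ i b, |c i b| ≤ B)
    (hc : ∀ i, Tendsto (c i) atTop (𝓝 (v i))) :
    Tendsto (fun b : ℝ => ∫ U, ∏ i, (g i U - c i b) ∂(wilsonMeasure ρ b)) atTop (𝓝 0) := by
  haveI : ∀ b : ℝ, IsProbabilityMeasure (wilsonMeasure (d := 4) (L := S) (G := G) ρ b) :=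
    fun b => isProbabilityMeasure_wilsonMeasure ρ hρ b
  -- the `L¹` norm of ONE centred factor freezes
  have hF : Continuous fun U : GaugeConfig 4 S G => |g i₀ U - v i₀| :=
    continuous_abs.comp ((hg i₀).sub continuous_const)
  have h1 : Tendsto (fun b : ℝ => ∫ U, |g i₀ U - v i₀| ∂(wilsonMeasure ρ b)) atTop (𝓝 0) :=
    tendsto_integral_wilsonMeasure ρ hρ hρN hF (c := 0) fun U hU => by simp [hv i₀ U hU]
  have h2 : Tendsto (fun b : ℝ => |v i₀ - c i₀ b|) atTop (𝓝 0) := by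
    have h2' : Tendsto (fun b : ℝ => v i₀ - c i₀ b) atTop (𝓝 (v i₀ - v i₀)) :=
      tendsto_const_nhds.sub (hc i₀)
    simpa using h2'.abs
  have hbound : Tendsto (fun b : ℝ => (2 * B) ^ (p - 1) *
      (∫ U, |g i₀ U - v i₀| ∂(wilsonMeasure ρ b) + |v i₀ - c i₀ b|)) atTop (𝓝 0) := by
    simpa using (h1.add h2).const_mul ((2 * B) ^ (p - 1))
  refine squeeze_zero_norm (fun b => ?_) hbound
  rw [Real.norm_eq_abs]
  -- pointwise domination of the product by one factor
  have hptw : ∀ U, |∏ i, (g i U - c i b)| ≤ (2 * B) ^ (p - 1) * |g i₀ U - c i₀ b| := fun U =>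
    abs_prod_le_pow_mul_abs i₀ (fun i => g i U - c i b) fun i =>
      (abs_sub _ _).trans (by linarith [hB i U, hcB i b])
  have hB0 : 0 ≤ 2 * B := by
    have := hptw (fun _ => 1)
    exact (abs_nonneg _).trans ((hB i₀ fun _ => 1).trans (by linarith [abs_nonneg (g i₀ fun _ => 1), hB i₀ fun _ => 1]))
  have hint1 : Integrable (fun U => |g i₀ U - c i₀ b|) (wilsonMeasure ρ b) :=
    integrable_of_continuous _ (continuous_abs.comp ((hg i₀).sub continuous_const))
  have hint2 : Integrable (fun U => |g i₀ U - v i₀|) (wilsonMeasure ρ b) :=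
    integrable_of_continuous _ hF
  calc |∫ U, ∏ i, (g i U - c i b) ∂(wilsonMeasure ρ b)|
      ≤ ∫ U, |∏ i, (g i U - c i b)| ∂(wilsonMeasure ρ b) := abs_integral_le_integral_abs
    _ ≤ ∫ U, (2 * B) ^ (p - 1) * |g i₀ U - c i₀ b| ∂(wilsonMeasure ρ b) := by
        refine integral_mono ?_ (hint1.const_mul _) hptw
        exact (integrable_of_continuous _
          (continuous_finsetProd _ fun i _ => (hg i).sub continuous_const)).abs
    _ = (2 * B) ^ (p - 1) * ∫ U, |g i₀ U - c i₀ b| ∂(wilsonMeasure ρ b) := integral_const_mul _ _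
    _ ≤ (2 * B) ^ (p - 1) * (∫ U, |g i₀ U - v i₀| ∂(wilsonMeasure ρ b) + |v i₀ - c i₀ b|) := by
        refine mul_le_mul_of_nonneg_left ?_ (pow_nonneg hB0 _)
        calc ∫ U, |g i₀ U - c i₀ b| ∂(wilsonMeasure ρ b)
            ≤ ∫ U, (|g i₀ U - v i₀| + |v i₀ - c i₀ b|) ∂(wilsonMeasure ρ b) :=
              integral_mono hint1 (hint2.add (integrable_const _)) fun U => abs_sub_le _ _ _
          _ = ∫ U, |g i₀ U - v i₀| ∂(wilsonMeasure ρ b) + |v i₀ - c i₀ b| := by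
              rw [integral_add hint2 (integrable_const _), integral_const]
              simp

/-! ## §2 The observable alphabet: single plaquettes and the action density -/

/-- The alphabet of observables used by the line's vocabulary: `none` ↦ the curvature species
`r.curvature` (Wilson action density), `some q` ↦ the single-plaquette species `plaq r q`. -/
def obsOf (r : LatticeRep G) : Option PlaqIdx → YMSpecies G
  | none => r.curvature
  | some q => plaq r q

/-- Frozen (flat-configuration) values: `6N` for the action density, `N` for a plaquette. -/
def flatVal (r : LatticeRep G) : Option PlaqIdx → ℝ
  | none => ∑ i : Fin 4, ∑ j : Fin 4, if i < j then (r.N : ℝ) else 0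
  | some _ => r.N

/-- Uniform bound `6N` on every letter of the alphabet. -/
theorem abs_obsOf_le (r : LatticeRep G) (s : Option PlaqIdx) (W : LGConfig 4 G) :
    |(obsOf r s).F W| ≤ 6 * r.N := by
  have hN : (0 : ℝ) ≤ r.N := Nat.cast_nonneg _
  -- `|Re tr ρ(g)| ≤ N` for the unitary representation `ρ`
  have abs_re_trace_le : ∀ g : G, |(r.ρ g).trace.re| ≤ r.N := fun g => by
    have hM := r.mem_unitary g
    calc |(r.ρ g).trace.re| ≤ ‖(r.ρ g).trace‖ := Complex.abs_re_le_norm _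
      _ = ‖∑ i, r.ρ g i i‖ := rfl
      _ ≤ ∑ i, ‖r.ρ g i i‖ := norm_sum_le _ _
      _ ≤ ∑ _i : Fin r.N, (1 : ℝ) := Finset.sum_le_sum fun i _ => entry_norm_bound_of_unitary hM i i
      _ = r.N := by simp
  cases s with
  | none =>
    change |actionDensity r.ρ W| ≤ 6 * r.N
    unfold actionDensity
    calc |∑ i : Fin 4, ∑ j : Fin 4, if i < j then plaquetteObs r.ρ 0 i j W else 0|
        ≤ ∑ i : Fin 4, |∑ j : Fin 4, if i < j then plaquetteObs r.ρ 0 i j W else 0| :=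
          Finset.abs_sum_le_sum_abs _ _
      _ ≤ ∑ i : Fin 4, ∑ j : Fin 4, |if i < j then plaquetteObs r.ρ 0 i j W else 0| :=
          Finset.sum_le_sum fun i _ => Finset.abs_sum_le_sum_abs _ _
      _ ≤ ∑ i : Fin 4, ∑ j : Fin 4, (if i < j then (r.N : ℝ) else 0) :=
          Finset.sum_le_sum fun i _ => Finset.sum_le_sum fun j _ => by
            split_ifs with h
            · exact abs_re_trace_le _
            · simp
      _ = 6 * r.N := by simp [Fin.sum_univ_four]; ring
  | some q =>
    change |plaquetteObs r.ρ 0 q.1.1 q.1.2 W| ≤ 6 * r.N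
    exact (abs_re_trace_le _).trans (by linarith)

/-- Every letter, translated and read on the periodic lift, is a continuous function of the torus
configuration. -/
theorem continuous_obsOf_shift_lift (r : LatticeRep G) (s : Option PlaqIdx) (x : Site 4) (S : ℕ) :
    Continuous fun U : GaugeConfig 4 S G => (obsOf r s).F (configShift (-x) (torusLift S U)) := by
  have hlift := (continuous_configShift (G := G) (-x)).comp
    (TunedSequenceExists.Negative.Freezing.continuous_torusLift (G := G) S)
  cases s with
  | none => exact (continuous_actionDensity r.continuous).comp hlift
  | some q => exact (continuous_plaquetteObs r.ρ r.continuous 0 q.1.1 q.1.2).comp hlift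

/-- On flat torus configurations every letter is frozen at its flat value (any translation). -/
theorem obsOf_shift_lift_of_flat (r : LatticeRep G) (s : Option PlaqIdx) (x : Site 4) {S : ℕ} [NeZero S]
    {U : GaugeConfig 4 S G} (hU : wilsonAction r.ρ U = 0) :
    (obsOf r s).F (configShift (-x) (torusLift S U)) = flatVal r s := by
  have hρN : ∀ g, (r.ρ g).trace.re ≤ r.N := fun g => re_trace_le_of_mem_unitaryGroup (r.mem_unitary g)
  cases s with
  | none => exact actionDensity_configShift_torusLift_eq r.ρ hρN hU (-x)
  | some q =>
    change plaquetteObs r.ρ 0 q.1.1 q.1.2 (configShift (-x) (torusLift S U)) = (r.N : ℝ)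
    simp only [plaquetteObs, plaquetteHolonomyZd_configShift, plaquetteHolonomyZd_torusLift']
    exact re_trace_eq_of_wilsonAction_eq_zero r.ρ hρN hU _ _ _ q.2

/-- The untranslated case: `configShift (-0)` is the identity. -/
theorem obsOf_lift_of_flat (r : LatticeRep G) (s : Option PlaqIdx) {S : ℕ} [NeZero S]
    {U : GaugeConfig 4 S G} (hU : wilsonAction r.ρ U = 0) :
    (obsOf r s).F (torusLift S U) = flatVal r s := by
  have hz : ∀ W : LGConfig 4 G, configShift (0 : Site 4) W = W := fun W => by
    funext e; simp [Literature.MathematicalPhysics.QuantumLattice.configShift_apply]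
  have h := obsOf_shift_lift_of_flat r s 0 hU
  rwa [neg_zero, hz] at h

/-! ## §3 Centred moments and their freezing -/

/-- **Centred plaquette-string moment** on the torus of half-side `L` at coupling `β`: the string `σ`
of letters placed at the sites `x`, each centred by its torus Wilson mean —
`∫ ∏ᵢ (O_{σᵢ}(τ_{xᵢ}Ũ) − ⟨O_{σᵢ}⟩_{β,2L+1}) dμ_{β,2L+1}`; these are the coefficients of every canonical
lattice distribution of the line's vocabulary (`canonDistribution`, `curvDistribution`, `curvNPoint`). -/
def centredMoment (r : LatticeRep G) (L : ℕ) (β : ℝ) (p : ℕ) (σ : Fin p → Option PlaqIdx)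
    (x : Fin p → Site 4) : ℝ :=
  ∫ U, ∏ i, ((obsOf r (σ i)).F (configShift (-(x i)) (torusLift (2 * L + 1) U)) -
      wilsonTorusMean r.ρ β L (obsOf r (σ i)).F)
    ∂(wilsonMeasure (d := 4) (L := 2 * L + 1) r.ρ β)

/-- The torus Wilson mean of a letter is bounded by `6N`. -/
theorem abs_wilsonTorusMean_obsOf_le (r : LatticeRep G) (β : ℝ) (L : ℕ) (s : Option PlaqIdx) :
    |wilsonTorusMean r.ρ β L (obsOf r s).F| ≤ 6 * r.N := by
  haveI : IsProbabilityMeasure (wilsonMeasure (d := 4) (L := 2 * L + 1) (G := G) r.ρ β) :=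
    isProbabilityMeasure_wilsonMeasure r.ρ r.continuous β
  unfold wilsonTorusMean
  calc |∫ U, (obsOf r s).F (torusLift (2 * L + 1) U) ∂(wilsonMeasure r.ρ β)|
      ≤ ∫ U, |(obsOf r s).F (torusLift (2 * L + 1) U)| ∂(wilsonMeasure r.ρ β) :=
        abs_integral_le_integral_abs
    _ ≤ ∫ _U, 6 * (r.N : ℝ) ∂(wilsonMeasure (d := 4) (L := 2 * L + 1) r.ρ β) := by
        refine integral_mono_of_nonneg (ae_of_all _ fun U => abs_nonneg _) (integrable_const _)
          (ae_of_all _ fun U => abs_obsOf_le r s _)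
    _ = 6 * r.N := by rw [integral_const]; simp

/-- The torus Wilson mean of a letter freezes at its flat value as `β → ∞`. -/
theorem tendsto_wilsonTorusMean_obsOf (r : LatticeRep G) (L : ℕ) (s : Option PlaqIdx) :
    Tendsto (fun β : ℝ => wilsonTorusMean r.ρ β L (obsOf r s).F) atTop (𝓝 (flatVal r s)) := by
  haveI : SecondCountableTopology G := secondCountable_of_latticeRep r
  have hρN : ∀ g, (r.ρ g).trace.re ≤ r.N := fun g => re_trace_le_of_mem_unitaryGroup (r.mem_unitary g)
  have hc : Continuous fun U : GaugeConfig 4 (2 * L + 1) G => (obsOf r s).F (torusLift (2 * L + 1) U) := by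
    have hz : ∀ W : LGConfig 4 G, configShift (0 : Site 4) W = W := fun W => by
      funext e; simp [Literature.MathematicalPhysics.QuantumLattice.configShift_apply]
    have h := continuous_obsOf_shift_lift r s 0 (2 * L + 1)
    simpa only [neg_zero, hz] using h
  exact tendsto_integral_wilsonMeasure r.ρ r.continuous hρN hc fun U hU => obsOf_lift_of_flat r s hU

/-- **Freezing of centred moments**: on a fixed torus every centred plaquette-string moment of
positive length tends to `0` as `β → ∞`. -/
theorem tendsto_centredMoment (r : LatticeRep G) (L : ℕ) {p : ℕ} (i₀ : Fin p)
    (σ : Fin p → Option PlaqIdx) (x : Fin p → Site 4) :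
    Tendsto (fun β : ℝ => centredMoment r L β p σ x) atTop (𝓝 0) := by
  haveI : SecondCountableTopology G := secondCountable_of_latticeRep r
  have hρN : ∀ g, (r.ρ g).trace.re ≤ r.N := fun g => re_trace_le_of_mem_unitaryGroup (r.mem_unitary g)
  exact tendsto_integral_prod_sub r.ρ r.continuous hρN i₀
    (fun i => continuous_obsOf_shift_lift r (σ i) (x i) (2 * L + 1))
    (fun i U hU => obsOf_shift_lift_of_flat r (σ i) (x i) hU)
    (fun i U => abs_obsOf_le r (σ i) _) (fun i b => abs_wilsonTorusMean_obsOf_le r b L (σ i))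
    (fun i => tendsto_wilsonTorusMean_obsOf r L (σ i))

/-- The finite index of all strings of length `≤ k` over the alphabet with positions in `box 4 L`. -/
abbrev MomentIdx (L k : ℕ) : Type :=
  Σ p : Fin (k + 1), (Fin p → Option PlaqIdx) × (Fin p → ↥(box 4 L))

/-- **One threshold for all short strings**: for every `ε > 0`, eventually in `β`, EVERY centred
moment of length `1 ≤ p ≤ k` over the alphabet, at any positions in `box 4 L`, is at most `ε` in
modulus (finitely many moments, each frozen). -/
theorem eventually_abs_centredMoment_le (r : LatticeRep G) (L k : ℕ) {ε : ℝ} (hε : 0 < ε) :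
    ∀ᶠ β : ℝ in atTop, ∀ p : ℕ, p ≤ k → 1 ≤ p → ∀ (σ : Fin p → Option PlaqIdx) (x : Fin p → ↥(box 4 L)),
      |centredMoment r L β p σ (fun i => (x i : Site 4))| ≤ ε := by
  have hidx : ∀ ι : MomentIdx L k, ∀ᶠ β : ℝ in atTop, 1 ≤ (ι.1 : ℕ) →
      |centredMoment r L β ι.1 ι.2.1 (fun i => (ι.2.2 i : Site 4))| ≤ ε := by
    rintro ⟨p, σ, x⟩
    by_cases hp : 1 ≤ (p : ℕ)
    · have ht := tendsto_centredMoment r L ⟨0, hp⟩ σ (fun i => (x i : Site 4))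
      filter_upwards [(Metric.tendsto_nhds.1 ht) ε hε] with β hβ _
      rw [Real.dist_eq, sub_zero] at hβ
      exact hβ.le
    · exact Eventually.of_forall fun β h => absurd h hp
  filter_upwards [Filter.eventually_all.2 hidx] with β hβ p hpk hp σ x
  exact hβ ⟨⟨p, Nat.lt_succ_of_le hpk⟩, σ, x⟩ hp


/-! NOTE: this crux workfile is the CONCATENATION (for stand-alone elaboration) of the three proposal files
`Theorems/ContinuumLimitExists/Negative/{FrozenMoments, OvercooledCanonicalScheme, OvercooledUUVB}.lean`
(p154212 + successors); see their module docstrings, reproduced inline below as section comments. -/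

open scoped SchwartzMap
open Literature.MathematicalPhysics.AQFT

local notation "𝔼" => EuclideanSpace ℝ (Fin 4)

/-! ## §1 Canonical distributions of alphabet strings are finite sums of centred moments -/

/-- **Lattice-sum form.** The canonical lattice distribution of a string over the alphabet is the
finite sum, over positions in `box 4 L_k`, of the test function at the scaled positions times the
centred moment of part I. -/
theorem canonDistribution_obsOf_eq_sum (r : LatticeRep G) (sch : SpeciesScheme (YMSpecies G)) (k p : ℕ)
    (τ : Fin p → Option PlaqIdx) (F : 𝓢((Fin p → 𝔼), ℂ)) :
    canonDistribution r sch k p (fun i => obsOf r (τ i)) F =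
      ∑ x : Fin p → ↥(box 4 (sch.L k)), F (fun i => sch.a k • siteToE (↑(x i) : Site 4)) *
        ((centredMoment r (sch.L k) (sch.β k) p τ (fun i => (x i : Site 4)) : ℝ) : ℂ) := by
  haveI : SecondCountableTopology G := secondCountable_of_latticeRep r
  haveI : IsProbabilityMeasure (wilsonMeasure (d := 4) (L := sch.side k) (G := G) r.ρ (sch.β k)) :=
    isProbabilityMeasure_wilsonMeasure r.ρ r.continuous _
  have hcont : ∀ x : Fin p → ↥(box 4 (sch.L k)), Continuous fun U : GaugeConfig 4 (sch.side k) G =>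
      ∏ i, ((obsOf r (τ i)).F (configShift (-(↑(x i) : Site 4)) (torusLift (sch.side k) U)) -
        wilsonTorusMean r.ρ (sch.β k) (sch.L k) (obsOf r (τ i)).F) := fun x =>
    continuous_finsetProd _ fun i _ =>
      (continuous_obsOf_shift_lift r (τ i) _ _).sub continuous_const
  unfold canonDistribution
  simp only [← Complex.ofReal_prod]
  rw [integral_finsetSum _ fun x _ => ((integrable_of_continuous _ (hcont x)).ofReal).const_mul _]
  refine Finset.sum_congr rfl fun x _ => ?_
  rw [integral_const_mul, integral_complex_ofReal]
  rfl

/-- **Sup-norm bound.** If every centred moment of the string at positions in the box is at most `ε`,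
the canonical distribution is at most `((2L_k+1)⁴)^p · |F|₀ · ε` (only the sup norm `schwartzNorm 0` of
the test function enters). -/
theorem norm_canonDistribution_obsOf_le (r : LatticeRep G) (sch : SpeciesScheme (YMSpecies G)) (k p : ℕ)
    (τ : Fin p → Option PlaqIdx) (F : 𝓢((Fin p → 𝔼), ℂ)) {ε : ℝ}
    (h : ∀ x : Fin p → ↥(box 4 (sch.L k)), |centredMoment r (sch.L k) (sch.β k) p τ (fun i => (x i : Site 4))| ≤ ε) :
    ‖canonDistribution r sch k p (fun i => obsOf r (τ i)) F‖ ≤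
      ((2 * (sch.L k : ℝ) + 1) ^ 4) ^ p * schwartzNorm 0 F * ε := by
  rw [canonDistribution_obsOf_eq_sum]
  refine (norm_sum_le _ _).trans ?_
  have hterm : ∀ x ∈ (Finset.univ : Finset (Fin p → ↥(box 4 (sch.L k)))),
      ‖F (fun i => sch.a k • siteToE (↑(x i) : Site 4)) *
        ((centredMoment r (sch.L k) (sch.β k) p τ (fun i => (x i : Site 4)) : ℝ) : ℂ)‖ ≤
          schwartzNorm 0 F * ε := fun x _ => by
    rw [norm_mul, Complex.norm_real, Real.norm_eq_abs]
    exact mul_le_mul (norm_le_schwartzNorm 0 F _) (h x) (abs_nonneg _) (schwartzNorm_nonneg _ _)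
  refine (Finset.sum_le_sum hterm).trans ?_
  rw [Finset.sum_const, nsmul_eq_mul, Finset.card_univ, Fintype.card_pi, Finset.prod_const,
    Finset.card_univ, Fintype.card_fin, Fintype.card_coe, card_box]
  push_cast
  ring_nf
  rfl

/-! ## §2 The over-cooled canonical scheme -/

/-- Torus half-side `L_k = (k+1)²`. -/
def ocL (k : ℕ) : ℕ := (k + 1) ^ 2

/-- The level-`k` smallness target `ε_k = ((k+1)·((2L_k+1)⁴)^k)⁻¹`. -/
def epsK (k : ℕ) : ℝ := ((k + 1 : ℝ) * (((2 * (ocL k : ℝ) + 1) ^ 4) ^ k))⁻¹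

/-- `ε_k > 0`. -/
theorem epsK_pos (k : ℕ) : 0 < epsK k := by
  have h1 : (0 : ℝ) < (k + 1 : ℝ) := by positivity
  have h2 : (0 : ℝ) < ((2 * (ocL k : ℝ) + 1) ^ 4) ^ k := by positivity
  exact inv_pos.2 (mul_pos h1 h2)

/-- A freezing threshold at level `k`: beyond it, every centred moment of length `1 ≤ p ≤ k` over the
alphabet on the torus of half-side `L_k` is at most `ε_k`. -/
theorem exists_threshold (r : LatticeRep G) (k : ℕ) : ∃ T : ℝ, ∀ β : ℝ, T ≤ β →
    ∀ p : ℕ, p ≤ k → 1 ≤ p → ∀ (τ : Fin p → Option PlaqIdx) (x : Fin p → ↥(box 4 (ocL k))),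
      |centredMoment r (ocL k) β p τ (fun i => (x i : Site 4))| ≤ epsK k :=
  Filter.eventually_atTop.1 (eventually_abs_centredMoment_le r (ocL k) k (epsK_pos k))

/-- The over-cooled coupling `β_k = max(k, T_k)`: at least `k` and beyond the level-`k` threshold. -/
def ocBeta (r : LatticeRep G) (k : ℕ) : ℝ := max (k : ℝ) (Classical.choose (exists_threshold r k))

/-- `k ≤ β_k`. -/
theorem le_ocBeta (r : LatticeRep G) (k : ℕ) : (k : ℝ) ≤ ocBeta r k := le_max_left _ _

/-- `β_k` is beyond the level-`k` freezing threshold: every centred moment of length `1 ≤ p ≤ k` is at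
most `ε_k`. -/
theorem ocBeta_spec (r : LatticeRep G) {k p : ℕ} (hpk : p ≤ k) (hp : 1 ≤ p) (τ : Fin p → Option PlaqIdx)
    (x : Fin p → ↥(box 4 (ocL k))) :
    |centredMoment r (ocL k) (ocBeta r k) p τ (fun i => (x i : Site 4))| ≤ epsK k :=
  Classical.choose_spec (exists_threshold r k) _ (le_max_right _ _) p hpk hp τ x

/-- **The over-cooled canonical scheme** of `r`: `a_k = 1/(k+1)`, `L_k = (k+1)²`, `β_k = ocBeta r k`
(`c`, `m` are unused by the canonical vocabulary and set to `0`). -/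
def overcooled (r : LatticeRep G) : SpeciesScheme (YMSpecies G) where
  a := fun k => ((k : ℝ) + 1)⁻¹
  a_pos := fun k => by positivity
  tendsto_a := tendsto_inv_atTop_zero.comp (tendsto_natCast_atTop_atTop.atTop_add tendsto_const_nhds)
  β := ocBeta r
  L := ocL
  tendsto_L := by
    have h : (fun k : ℕ => ((k : ℝ) + 1)⁻¹ * ((ocL k : ℕ) : ℝ)) = fun k : ℕ => (k : ℝ) + 1 := by
      funext k; unfold ocL; push_cast; field_simp
    rw [h]
    exact tendsto_natCast_atTop_atTop.atTop_add tendsto_const_nhds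
  c := fun _ _ => 0
  m := fun _ _ => 0

/-- The torus half-side of the over-cooled scheme. -/
@[simp] theorem overcooled_L (r : LatticeRep G) (k : ℕ) : (overcooled r).L k = ocL k := rfl

/-- The coupling of the over-cooled scheme. -/
@[simp] theorem overcooled_β (r : LatticeRep G) (k : ℕ) : (overcooled r).β k = ocBeta r k := rfl

/-- The spacing of the over-cooled scheme. -/
@[simp] theorem overcooled_a (r : LatticeRep G) (k : ℕ) : (overcooled r).a k = ((k : ℝ) + 1)⁻¹ := rfl

/-- **Weak coupling**: `β_k ≥ k → ∞`. -/
theorem hasWeakCouplingLimit_overcooled (r : LatticeRep G) : (overcooled r).HasWeakCouplingLimit :=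
  tendsto_atTop_mono (le_ocBeta r) tendsto_natCast_atTop_atTop

/-- **Polynomial volume growth** with exponent `N = 1`: `a_k⁻¹ = k+1 = a_k L_k`. -/
theorem polyVolumeGrowth_overcooled (r : LatticeRep G) : PolyVolumeGrowth (overcooled r) := by
  refine ⟨1, le_rfl, Eventually.of_forall fun k => ?_⟩
  simp only [overcooled_a, overcooled_L, ocL, inv_inv, pow_one]
  push_cast
  have hk : (0 : ℝ) < (k : ℝ) + 1 := by positivity
  rw [← div_eq_inv_mul, le_div_iff₀ hk]
  nlinarith

/-! ## §3 Every canonical distribution of the over-cooled scheme is small -/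

/-- **Smallness**: for `1 ≤ p ≤ k`, every canonical lattice distribution of an alphabet string at level
`k` of the over-cooled scheme is at most `|F|₀/(k+1)`. -/
theorem norm_canonDistribution_overcooled_le (r : LatticeRep G) {k p : ℕ} (hp : 1 ≤ p) (hpk : p ≤ k)
    (τ : Fin p → Option PlaqIdx) (F : 𝓢((Fin p → 𝔼), ℂ)) :
    ‖canonDistribution r (overcooled r) k p (fun i => obsOf r (τ i)) F‖ ≤ schwartzNorm 0 F / (k + 1) := by
  have h := norm_canonDistribution_obsOf_le r (overcooled r) k p τ F
    (fun x => ocBeta_spec r hpk hp τ x)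
  refine h.trans ?_
  simp only [overcooled_L]
  have hs : (1 : ℝ) ≤ (2 * (ocL k : ℝ) + 1) ^ 4 :=
    one_le_pow₀ (by have h0 : (0 : ℝ) ≤ 2 * (ocL k : ℝ) := by positivity
                    linarith)
  have hpow : ((2 * (ocL k : ℝ) + 1) ^ 4) ^ p ≤ ((2 * (ocL k : ℝ) + 1) ^ 4) ^ k :=
    pow_le_pow_right₀ hs hpk
  have hk : (0 : ℝ) < (k : ℝ) + 1 := by positivity
  have hS : (0 : ℝ) < ((2 * (ocL k : ℝ) + 1) ^ 4) ^ k := by positivity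
  have hN := schwartzNorm_nonneg 0 F
  unfold epsK
  rw [div_eq_mul_inv, mul_inv]
  calc ((2 * (ocL k : ℝ) + 1) ^ 4) ^ p * schwartzNorm 0 F * (((k : ℝ) + 1)⁻¹ * (((2 * (ocL k : ℝ) + 1) ^ 4) ^ k)⁻¹)
      = (((2 * (ocL k : ℝ) + 1) ^ 4) ^ p * (((2 * (ocL k : ℝ) + 1) ^ 4) ^ k)⁻¹) *
          (schwartzNorm 0 F * ((k : ℝ) + 1)⁻¹) := by ring
    _ ≤ 1 * (schwartzNorm 0 F * ((k : ℝ) + 1)⁻¹) := by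
        refine mul_le_mul_of_nonneg_right ?_ (by positivity)
        rw [mul_inv_le_iff₀ hS, one_mul]
        exact hpow
    _ = schwartzNorm 0 F * ((k : ℝ) + 1)⁻¹ := one_mul _

/-- The curvature string: every canonical curvature `p`-point distribution (`1 ≤ p ≤ k`) is at most
`|F|₀/(k+1)`. -/
theorem norm_curvDistribution_overcooled_le (r : LatticeRep G) {k p : ℕ} (hp : 1 ≤ p) (hpk : p ≤ k)
    (F : 𝓢((Fin p → 𝔼), ℂ)) :
    ‖curvDistribution r (overcooled r) k p F‖ ≤ schwartzNorm 0 F / (k + 1) := by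
  rw [← canonDistribution_curvature]
  exact norm_canonDistribution_overcooled_le r hp hpk (fun _ => none) F

/-- A `k`-uniform bound including arity `0`: for `p ≤ k`, `‖curvDistribution‖ ≤ |F|₀`. -/
theorem norm_curvDistribution_overcooled_le' (r : LatticeRep G) {k p : ℕ} (hpk : p ≤ k)
    (F : 𝓢((Fin p → 𝔼), ℂ)) :
    ‖curvDistribution r (overcooled r) k p F‖ ≤ schwartzNorm 0 F := by
  rcases Nat.eq_zero_or_pos p with rfl | hp
  · rw [curvDistribution_zero]; exact norm_le_schwartzNorm 0 F _
  · refine (norm_curvDistribution_overcooled_le r hp hpk F).trans ?_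
    have hk : (1 : ℝ) ≤ (k : ℝ) + 1 := by
      have : (0 : ℝ) ≤ k := Nat.cast_nonneg k
      linarith
    exact div_le_self (schwartzNorm_nonneg 0 F) hk

/-- **All canonical curvature functions of the over-cooled scheme tend to `0`** (`p ≥ 1`). -/
theorem tendsto_curvDistribution_overcooled (r : LatticeRep G) {p : ℕ} (hp : 1 ≤ p)
    (F : 𝓢((Fin p → 𝔼), ℂ)) :
    Tendsto (fun k => curvDistribution r (overcooled r) k p F) atTop (𝓝 0) := by
  have hlim : Tendsto (fun k : ℕ => schwartzNorm 0 F / ((k : ℝ) + 1)) atTop (𝓝 0) :=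
    tendsto_const_nhds.div_atTop (tendsto_natCast_atTop_atTop.atTop_add tendsto_const_nhds)
  refine squeeze_zero_norm' ?_ hlim
  filter_upwards [eventually_ge_atTop p] with k hk
  exact norm_curvDistribution_overcooled_le r hp hk F

/-! ## §4 What the over-cooled scheme satisfies and what it violates -/

/-- **`ConvProducts` holds**: every canonical curvature `p`-point function on a real product tensor
converges — to `0`. -/
theorem convProducts_overcooled (r : LatticeRep G) : ConvProducts r (overcooled r) := by
  intro p hp f _
  refine ⟨0, ?_⟩
  have ht := tendsto_curvDistribution_overcooled r (Nat.one_le_iff_ne_zero.2 hp)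
    (SchwartzMap.tensorFin p fun i => ofRealTest (f i))
  have hre := (Complex.continuous_re.tendsto 0).comp ht
  refine hre.congr fun k => ?_
  simp only [Function.comp_apply,
    curvDistribution_tensor r (overcooled r) k p (isTensorOf_tensorFin fun i => ofRealTest (f i)),
    Complex.ofReal_re]

/-- **`ND2` fails**: no time-ordered pair has a canonical two-point distribution bounded away from `0`. -/
theorem not_ND2_overcooled (r : LatticeRep G) : ¬ ND2 r (overcooled r) := by
  rintro ⟨F, G₁, H, -, -, -, δ, hδ, hev⟩
  have ht := tendsto_curvDistribution_overcooled r (p := 1 + 1) (by norm_num) H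
  have hsmall : ∀ᶠ k in atTop, ‖curvDistribution r (overcooled r) k (1 + 1) H‖ < δ := by
    filter_upwards [(Metric.tendsto_nhds.1 ht) δ hδ] with k hk
    simpa [dist_zero_right] using hk
  obtain ⟨k, h1, h2⟩ := (hev.and hsmall).exists
  exact absurd h1 (not_le.2 h2)

/-- **`ND3` fails**: no off-diagonal triple has a canonical three-point distribution bounded away
from `0`. -/
theorem not_ND3_overcooled (r : LatticeRep G) : ¬ ND3 r (overcooled r) := by
  rintro ⟨f, g, h, F₃, -, -, δ, hδ, hev⟩
  have ht := tendsto_curvDistribution_overcooled r (p := 3) (by norm_num) F₃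
  have hsmall : ∀ᶠ k in atTop, ‖curvDistribution r (overcooled r) k 3 F₃‖ < δ := by
    filter_upwards [(Metric.tendsto_nhds.1 ht) δ hδ] with k hk
    simpa [dist_zero_right] using hk
  obtain ⟨k, h1, h2⟩ := (hev.and hsmall).exists
  exact absurd h1 (not_le.2 h2)

/-- **`Rot345` holds (trivially)**: rotating the test function changes the canonical curvature
distributions by `o(1)` — both tend to `0`. -/
theorem rot345_overcooled (r : LatticeRep G) : Rot345 r (overcooled r) := by
  intro R _ _ _ _ p F _
  rcases Nat.eq_zero_or_pos p with rfl | hp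
  · have h0 : ∀ k, curvDistribution r (overcooled r) k 0 (linActMulti R F) -
        curvDistribution r (overcooled r) k 0 F = 0 := fun k => by
      rw [curvDistribution_zero, curvDistribution_zero, linActMulti_apply, sub_eq_zero]
      exact congrArg F (Subsingleton.elim _ _)
    simp only [h0]
    exact tendsto_const_nhds
  · have h := (tendsto_curvDistribution_overcooled r hp (linActMulti R F)).sub
      (tendsto_curvDistribution_overcooled r hp F)
    rwa [sub_zero] at h

/-- Products with one vanishing factor: if `‖u_k‖ ≤ M` eventually and `v_k → 0` then `u_k v_k → 0` and
`v_k u_k → 0` (complex sequences). -/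
theorem tendsto_mul_zero_of_bounded {u v : ℕ → ℂ} {M : ℝ} (hu : ∀ᶠ k in atTop, ‖u k‖ ≤ M)
    (hv : Tendsto v atTop (𝓝 0)) : Tendsto (fun k => u k * v k) atTop (𝓝 0) := by
  have hM : Tendsto (fun k => M * ‖v k‖) atTop (𝓝 0) := by
    simpa using (tendsto_norm_zero.comp hv).const_mul M
  refine squeeze_zero_norm' ?_ hM
  filter_upwards [hu] with k hk
  rw [norm_mul]
  exact mul_le_mul_of_nonneg_right hk (norm_nonneg _)

/-- **`CoreClustering` holds (trivially)**: every clustering defect tends to `0` because every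
positive-arity canonical distribution does, and the arity-`0` ones are evaluations. -/
theorem coreClustering_overcooled (r : LatticeRep G) : CoreClustering r (overcooled r) := by
  intro n₁ n₂ Low Up _ _ crd _ P _ _ b _ _ ε hε
  refine ⟨0, fun t _ => ?_⟩
  set X := translateMulti (t • b) Up with hX
  -- the clustering defect tends to `0` along `k`
  have hdef : Tendsto (fun k => curvDistribution r (overcooled r) k (n₁ + n₂) (Low.appendTensor X) -
      curvDistribution r (overcooled r) k n₁ Low * curvDistribution r (overcooled r) k n₂ X)
      atTop (𝓝 0) := by
    rcases Nat.eq_zero_or_pos n₁ with rfl | h₁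
    · rcases Nat.eq_zero_or_pos n₂ with rfl | h₂
      · -- both arities `0`: the defect is identically `0`
        have h0 : ∀ k, curvDistribution r (overcooled r) k (0 + 0) (Low.appendTensor X) -
            curvDistribution r (overcooled r) k 0 Low * curvDistribution r (overcooled r) k 0 X = 0 := by
          intro k
          have e : curvDistribution r (overcooled r) k (0 + 0) (Low.appendTensor X) =
              (Low.appendTensor X) default := curvDistribution_zero r (overcooled r) k _
          rw [e, curvDistribution_zero, curvDistribution_zero, SchwartzMap.appendTensor_apply, sub_eq_zero]
          exact congrArg₂ (· * ·) (congrArg Low (Subsingleton.elim _ _)) (congrArg X (Subsingleton.elim _ _))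
        simp only [h0]
        exact tendsto_const_nhds
      · -- `n₁ = 0 < n₂`
        have hA := tendsto_curvDistribution_overcooled r (p := 0 + n₂) (by omega) (Low.appendTensor X)
        have hB : Tendsto (fun k => curvDistribution r (overcooled r) k 0 Low *
            curvDistribution r (overcooled r) k n₂ X) atTop (𝓝 0) :=
          tendsto_mul_zero_of_bounded (M := schwartzNorm 0 Low)
            (Eventually.of_forall fun k => norm_curvDistribution_overcooled_le' r (Nat.zero_le k) Low)
            (tendsto_curvDistribution_overcooled r h₂ X)
        simpa using hA.sub hB
    · have hA := tendsto_curvDistribution_overcooled r (p := n₁ + n₂) (by omega) (Low.appendTensor X)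
      have hB : Tendsto (fun k => curvDistribution r (overcooled r) k n₁ Low *
          curvDistribution r (overcooled r) k n₂ X) atTop (𝓝 0) := by
        have h := tendsto_mul_zero_of_bounded (M := schwartzNorm 0 X)
          (u := fun k => curvDistribution r (overcooled r) k n₂ X)
          (v := fun k => curvDistribution r (overcooled r) k n₁ Low) ?_
          (tendsto_curvDistribution_overcooled r h₁ Low)
        · simpa [mul_comm] using h
        · filter_upwards [eventually_ge_atTop n₂] with k hk
          exact norm_curvDistribution_overcooled_le' r hk X
      simpa using hA.sub hB
  filter_upwards [(Metric.tendsto_nhds.1 hdef) ε hε] with k hk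
  rw [dist_zero_right] at hk
  exact hk.le

/-- **Summary (tightness of the `∃`-stub of line `birth`).** For every compact `G` admitting a faithful
unitary lattice representation, some scheme satisfies `HasWeakCouplingLimit ∧ PolyVolumeGrowth ∧
ConvProducts ∧ Rot345 ∧ CoreClustering` and violates `ND2` and `ND3`: the non-degeneracy clauses are the
load-bearing conjuncts of `stub_uvScheme`, and the conclusions of both `∀`-stubs are consistent with
(indeed implied by) total degeneration. -/
theorem exists_degenerate_scheme (r : LatticeRep G) :
    ∃ sch : SpeciesScheme (YMSpecies G), sch.HasWeakCouplingLimit ∧ PolyVolumeGrowth sch ∧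
      ConvProducts r sch ∧ Rot345 r sch ∧ CoreClustering r sch ∧ ¬ ND2 r sch ∧ ¬ ND3 r sch :=
  ⟨overcooled r, hasWeakCouplingLimit_overcooled r, polyVolumeGrowth_overcooled r, convProducts_overcooled r,
    rot345_overcooled r, coreClustering_overcooled r, not_ND2_overcooled r, not_ND3_overcooled r⟩


/-! ## §1 Elementary: `p^p ≤ (p!)²` -/

/-- `p^p ≤ (p!)²`: pair the factor `i+1` of `p!` with the factor `p-i` of `p!`; each product
`(i+1)(p-i) = p + i(p-1-i)` is at least `p`. -/
theorem pow_self_le_factorial_sq (p : ℕ) : p ^ p ≤ (p.factorial) ^ 2 := by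
  have h1 : (∏ i ∈ range p, (i + 1)) = p.factorial := Finset.prod_range_add_one_eq_factorial p
  have h2 : (∏ i ∈ range p, (p - i)) = p.factorial := by
    rw [← Finset.prod_range_reflect, ← h1]
    refine Finset.prod_congr rfl fun i hi => ?_
    rw [Finset.mem_range] at hi
    omega
  calc p ^ p = ∏ _i ∈ range p, p := by rw [Finset.prod_const, Finset.card_range]
    _ ≤ ∏ i ∈ range p, ((i + 1) * (p - i)) := by
        refine Finset.prod_le_prod' fun i hi => ?_
        rw [Finset.mem_range] at hi
        obtain ⟨d, rfl⟩ := Nat.exists_eq_add_of_lt hi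
        have : i + d + 1 - i = d + 1 := by omega
        rw [this]
        nlinarith
    _ = (p.factorial) ^ 2 := by rw [Finset.prod_mul_distrib, h1, h2, sq]

/-! ## §2 The crude bound (all arities, all levels) -/

/-- The arity-`0` centred moment is `1` (probability measure, empty product). -/
theorem centredMoment_zero (r : LatticeRep G) (L : ℕ) (β : ℝ) (τ : Fin 0 → Option PlaqIdx)
    (x : Fin 0 → Site 4) : centredMoment r L β 0 τ x = 1 := by
  haveI : IsProbabilityMeasure (wilsonMeasure (d := 4) (L := 2 * L + 1) (G := G) r.ρ β) :=
    isProbabilityMeasure_wilsonMeasure r.ρ r.continuous β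
  simp [centredMoment]

/-- **Crude bound on centred moments**: `|centredMoment| ≤ (12N)^p` (each centred factor is at most
`6N + 6N`). -/
theorem abs_centredMoment_le (r : LatticeRep G) (L : ℕ) (β : ℝ) (p : ℕ) (τ : Fin p → Option PlaqIdx)
    (x : Fin p → Site 4) : |centredMoment r L β p τ x| ≤ (12 * (r.N : ℝ)) ^ p := by
  haveI : IsProbabilityMeasure (wilsonMeasure (d := 4) (L := 2 * L + 1) (G := G) r.ρ β) :=
    isProbabilityMeasure_wilsonMeasure r.ρ r.continuous β
  unfold centredMoment
  have hfac : ∀ (U : GaugeConfig 4 (2 * L + 1) G) (i : Fin p),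
      |(obsOf r (τ i)).F (configShift (-(x i)) (torusLift (2 * L + 1) U)) -
        wilsonTorusMean r.ρ β L (obsOf r (τ i)).F| ≤ 12 * (r.N : ℝ) := fun U i => by
    have h1 := abs_obsOf_le r (τ i) (configShift (-(x i)) (torusLift (2 * L + 1) U))
    have h2 := abs_wilsonTorusMean_obsOf_le r β L (τ i)
    exact (abs_sub _ _).trans (by linarith)
  have hptw : ∀ U : GaugeConfig 4 (2 * L + 1) G,
      |∏ i, ((obsOf r (τ i)).F (configShift (-(x i)) (torusLift (2 * L + 1) U)) -
        wilsonTorusMean r.ρ β L (obsOf r (τ i)).F)| ≤ (12 * (r.N : ℝ)) ^ p := fun U => by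
    rw [Finset.abs_prod]
    refine (Finset.prod_le_prod (fun i _ => abs_nonneg _) fun i _ => hfac U i).trans ?_
    rw [Finset.prod_const, Finset.card_univ, Fintype.card_fin]
  calc |∫ U, ∏ i, ((obsOf r (τ i)).F (configShift (-(x i)) (torusLift (2 * L + 1) U)) -
          wilsonTorusMean r.ρ β L (obsOf r (τ i)).F) ∂(wilsonMeasure r.ρ β)|
      ≤ ∫ U, |∏ i, ((obsOf r (τ i)).F (configShift (-(x i)) (torusLift (2 * L + 1) U)) -
          wilsonTorusMean r.ρ β L (obsOf r (τ i)).F)| ∂(wilsonMeasure r.ρ β) := abs_integral_le_integral_abs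
    _ ≤ ∫ _U, (12 * (r.N : ℝ)) ^ p ∂(wilsonMeasure (d := 4) (L := 2 * L + 1) r.ρ β) :=
        integral_mono_of_nonneg (ae_of_all _ fun U => abs_nonneg _) (integrable_const _) (ae_of_all _ hptw)
    _ = (12 * (r.N : ℝ)) ^ p := by rw [integral_const]; simp

/-- **Crude bound on canonical distributions** (all `p`, all `k`):
`‖canonDistribution k p σ F‖ ≤ ((2L_k+1)⁴)^p (12N)^p |F|₀`. -/
theorem norm_canonDistribution_obsOf_crude (r : LatticeRep G) (sch : SpeciesScheme (YMSpecies G)) (k p : ℕ)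
    (τ : Fin p → Option PlaqIdx) (F : 𝓢((Fin p → 𝔼), ℂ)) :
    ‖canonDistribution r sch k p (fun i => obsOf r (τ i)) F‖ ≤
      ((2 * (sch.L k : ℝ) + 1) ^ 4) ^ p * schwartzNorm 0 F * (12 * (r.N : ℝ)) ^ p :=
  norm_canonDistribution_obsOf_le r sch k p τ F fun _ => abs_centredMoment_le r _ _ p τ _

/-- The arity-`0` canonical distribution is bounded by `|F|₀` (it is an evaluation). -/
theorem norm_canonDistribution_obsOf_zero_le (r : LatticeRep G) (sch : SpeciesScheme (YMSpecies G)) (k : ℕ)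
    (τ : Fin 0 → Option PlaqIdx) (F : 𝓢((Fin 0 → 𝔼), ℂ)) :
    ‖canonDistribution r sch k 0 (fun i => obsOf r (τ i)) F‖ ≤ schwartzNorm 0 F := by
  have h := norm_canonDistribution_obsOf_le r sch k 0 τ F (ε := 1) fun _ => by
    rw [centredMoment_zero]; simp
  simpa using h

/-! ## §3 `UUVB` for the over-cooled scheme -/

/-- The geometric input: for `k + 1 ≤ p`, `(2L_k+1)⁴ ≤ 81 p⁸`. -/
theorem side_pow_four_le (k p : ℕ) (hkp : k + 1 ≤ p) :
    (2 * (ocL k : ℝ) + 1) ^ 4 ≤ 81 * (p : ℝ) ^ 8 := by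
  have hp : ((k : ℝ) + 1) ≤ p := by exact_mod_cast hkp
  have hk0 : (0 : ℝ) ≤ (k : ℝ) + 1 := by positivity
  have h1 : (2 * (ocL k : ℝ) + 1) ≤ 3 * (p : ℝ) ^ 2 := by
    unfold ocL; push_cast
    nlinarith [mul_le_mul hp hp hk0 ((Nat.cast_nonneg k).trans (by linarith))]
  have h0 : (0 : ℝ) ≤ 2 * (ocL k : ℝ) + 1 := by positivity
  calc (2 * (ocL k : ℝ) + 1) ^ 4 ≤ (3 * (p : ℝ) ^ 2) ^ 4 := pow_le_pow_left₀ h0 h1 4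
    _ = 81 * (p : ℝ) ^ 8 := by ring

/-- The arithmetic input: for `972 N ≤ p`, `(81 p⁸)^p (12N)^p ≤ (p!)^18`. -/
theorem crude_le_factorial_pow (N p : ℕ) (hp : 972 * N ≤ p) (hp1 : 1 ≤ p) :
    (81 * (p : ℝ) ^ 8) ^ p * (12 * (N : ℝ)) ^ p ≤ ((p.factorial : ℝ)) ^ (18 : ℕ) := by
  have hN : (972 : ℝ) * N ≤ p := by exact_mod_cast hp
  have hp0 : (0 : ℝ) ≤ (p : ℝ) := Nat.cast_nonneg p
  -- `(81 p⁸)(12 N) = 972 N p⁸ ≤ p⁹`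
  have hstep : 81 * (p : ℝ) ^ 8 * (12 * (N : ℝ)) ≤ (p : ℝ) ^ 9 := by
    have : 81 * (p : ℝ) ^ 8 * (12 * (N : ℝ)) = (972 * (N : ℝ)) * (p : ℝ) ^ 8 := by ring
    rw [this, show (p : ℝ) ^ 9 = (p : ℝ) * (p : ℝ) ^ 8 by ring]
    exact mul_le_mul_of_nonneg_right hN (by positivity)
  -- `p^p ≤ (p!)²` in `ℝ`
  have hfac : ((p : ℝ) ^ 9) ^ p ≤ ((p.factorial : ℝ)) ^ (18 : ℕ) := by
    have hnat : (p ^ p : ℝ) ≤ ((p.factorial : ℝ)) ^ 2 := by exact_mod_cast pow_self_le_factorial_sq p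
    calc ((p : ℝ) ^ 9) ^ p = ((p : ℝ) ^ p) ^ 9 := by rw [← pow_mul, ← pow_mul, mul_comm]
      _ ≤ (((p.factorial : ℝ)) ^ 2) ^ 9 := pow_le_pow_left₀ (by positivity) hnat 9
      _ = ((p.factorial : ℝ)) ^ (18 : ℕ) := by rw [← pow_mul]
  calc (81 * (p : ℝ) ^ 8) ^ p * (12 * (N : ℝ)) ^ p = (81 * (p : ℝ) ^ 8 * (12 * (N : ℝ))) ^ p := by
        rw [← mul_pow]
    _ ≤ ((p : ℝ) ^ 9) ^ p := pow_le_pow_left₀ (by positivity) hstep p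
    _ ≤ ((p.factorial : ℝ)) ^ (18 : ℕ) := hfac

/-- **`UUVB` holds for the over-cooled scheme** with `s = 0`, `α = 1`, `β = 18`, threshold `k ≥ 972 N`. -/
theorem uuvb_overcooled (r : LatticeRep G) : UUVB r (overcooled r) := by
  refine ⟨0, 1, 18, ?_⟩
  filter_upwards [eventually_ge_atTop (972 * r.N)] with k hk p q F _
  rw [one_mul, Nat.mul_zero]
  have hfac1 : (1 : ℝ) ≤ ((p.factorial : ℝ)) ^ (18 : ℝ) := by
    have h1 : (1 : ℝ) ≤ (p.factorial : ℝ) := by exact_mod_cast Nat.one_le_iff_ne_zero.2 p.factorial_ne_zero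
    exact Real.one_le_rpow h1 (by norm_num)
  have hN := schwartzNorm_nonneg 0 F
  -- rewrite the real power `(p!)^(18:ℝ)` as a natural power
  have hrpow : ((p.factorial : ℝ)) ^ (18 : ℝ) = ((p.factorial : ℝ)) ^ (18 : ℕ) := by
    rw [← Real.rpow_natCast]; norm_num
  -- the string `plaq r ∘ q` is the alphabet string `some ∘ q`
  have hσ : (fun i => plaq r (q i)) = fun i => obsOf r (some (q i)) := rfl
  rw [hσ]
  rcases Nat.lt_or_ge k p with hkp | hpk
  · -- large arity `p > k ≥ 972 N`: crude bound against the factorial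
    have hp1 : 1 ≤ p := by omega
    refine (norm_canonDistribution_obsOf_crude r (overcooled r) k p _ F).trans ?_
    rw [overcooled_L, hrpow]
    have hside := side_pow_four_le k p hkp
    have h0 : (0 : ℝ) ≤ (2 * (ocL k : ℝ) + 1) ^ 4 := by positivity
    calc ((2 * (ocL k : ℝ) + 1) ^ 4) ^ p * schwartzNorm 0 F * (12 * (r.N : ℝ)) ^ p
        = (((2 * (ocL k : ℝ) + 1) ^ 4) ^ p * (12 * (r.N : ℝ)) ^ p) * schwartzNorm 0 F := by ring
      _ ≤ ((81 * (p : ℝ) ^ 8) ^ p * (12 * (r.N : ℝ)) ^ p) * schwartzNorm 0 F := by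
          refine mul_le_mul_of_nonneg_right ?_ hN
          exact mul_le_mul_of_nonneg_right (pow_le_pow_left₀ h0 hside p) (by positivity)
      _ ≤ ((p.factorial : ℝ)) ^ (18 : ℕ) * schwartzNorm 0 F :=
          mul_le_mul_of_nonneg_right (crude_le_factorial_pow r.N p (by omega) hp1) hN
  · -- small arity `p ≤ k`: evaluation (`p = 0`) or smallness (`1 ≤ p ≤ k`)
    have hle : ‖canonDistribution r (overcooled r) k p (fun i => obsOf r (some (q i))) F‖ ≤ schwartzNorm 0 F := by
      rcases Nat.eq_zero_or_pos p with rfl | hp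
      · exact norm_canonDistribution_obsOf_zero_le r (overcooled r) k _ F
      · refine (norm_canonDistribution_overcooled_le r hp hpk _ F).trans ?_
        have hk1 : (1 : ℝ) ≤ (k : ℝ) + 1 := by
          have : (0 : ℝ) ≤ k := Nat.cast_nonneg k
          linarith
        exact div_le_self hN hk1
    calc ‖canonDistribution r (overcooled r) k p (fun i => obsOf r (some (q i))) F‖
        ≤ schwartzNorm 0 F := hle
      _ = 1 * schwartzNorm 0 F := (one_mul _).symm
      _ ≤ ((p.factorial : ℝ)) ^ (18 : ℝ) * schwartzNorm 0 F := mul_le_mul_of_nonneg_right hfac1 hN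

/-- **Tightness of the `∃`-stub of line `birth` (final form).** For every compact `G` admitting a
faithful unitary lattice representation `r` there is a scheme with
`HasWeakCouplingLimit ∧ PolyVolumeGrowth ∧ ConvProducts ∧ UUVB ∧ Rot345 ∧ CoreClustering` — every
hypothesis-side conjunct of `stub_uvScheme` and both `∀`-stub conclusions — which violates `ND2` and
`ND3`. -/
theorem exists_degenerate_scheme_uuvb (r : LatticeRep G) :
    ∃ sch : SpeciesScheme (YMSpecies G), sch.HasWeakCouplingLimit ∧ PolyVolumeGrowth sch ∧
      ConvProducts r sch ∧ UUVB r sch ∧ Rot345 r sch ∧ CoreClustering r sch ∧ ¬ ND2 r sch ∧ ¬ ND3 r sch :=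
  ⟨overcooled r, hasWeakCouplingLimit_overcooled r, polyVolumeGrowth_overcooled r, convProducts_overcooled r,
    uuvb_overcooled r, rot345_overcooled r, coreClustering_overcooled r, not_ND2_overcooled r,
    not_ND3_overcooled r⟩

end Summit.QuantumFields.YangMills.Theorems.ContinuumLimitExists.Negative

end
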